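import Summits.KontsevichZagierPeriods.KontsevichZagierPeriods.Theorems.LinRedNormalFormArrangementNormalFormSeparateCut

/-!
# Iterated rule (1a) in every base dimension: cutting along finitely many rational hyperplanes

(Line `janus-bands`, crux `ArrangementNormalForm`, stub `stub_separateHigh` — separation in base
dimension `≥ 3`; part `Cuts`, valid in every base dimension `B` with `k` fibres.)

`SepHigh.cuts` (registered in literal form as `separateHigh_cuts`): cutting a Janus band
representation (literal `JJ B k` data) successively along the non-zero rational affine forms of
a finite set `S` (`separatePos_cut`); every piece is literal `JJ B k` data with the same
integrand data whose base rows contain the old rows and every form of `S` up to sign (so the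
piece lies in the parent domain and every form of `S` has a strict constant sign on it), and
`[s] ≡ ∑ [pieces]` modulo `KZ.relations`. This is the fine rational dissection of the base cell
(along the letters and a rational grid) used by `stub_separateHigh`.
-/

noncomputable section

open Set MeasureTheory

namespace Summit.KontsevichZagierPeriods.ArrangementNormalForm.JanusBands

open Literature.NumberTheory.Transcendental

namespace SepHigh

variable {B k m : ℕ}

/-- The pieces of an iterated cut of literal `JJ B k` data `(M, L, e, p, a, lo, hi)` along the
forms of `S`: literal data with the same integrand data whose rows contain the rows of `M` and
every form of `S` up to sign. -/
def Pieces (B k m : ℕ) (L : Fin m → (Fin B → ℚ) × ℚ) (e : Fin m → ℕ) (p : MvPolynomial (Fin B) ℚ)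
    (a : Fin k → Option ((Fin B → ℚ) × ℚ)) (lo hi : Fin k → Fin k ⊕ ((Fin B → ℚ) × ℚ))
    (S : Finset ((Fin B → ℚ) × ℚ)) (m' : ℕ) (M : Fin m' → (Fin B → ℚ) × ℚ) : Set KZ.FormalRep :=
  {w : KZ.FormalRep | ∃ (m₁ : ℕ) (M₁ : Fin m₁ → (Fin B → ℚ) × ℚ) (s₁ : KZ.IntegralRep (B + k)),
    (∀ j, ∃ j₁, M₁ j₁ = M j) ∧ (∀ h ∈ S, ∃ j₁, ∃ ε : ℚ, (ε = 1 ∨ ε = -1) ∧ M₁ j₁ = ε • h) ∧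
    Bornology.IsBounded s₁.domain ∧
    s₁.domain = {z | (∀ j, 0 < ∑ i, ((M₁ j).1 i : ℝ) * z (Fin.castAdd k i) + ((M₁ j).2 : ℝ)) ∧
      ∀ i, Sum.elim (fun j => z (Fin.natAdd B j)) (fun c => ∑ i', (c.1 i' : ℝ) *
        z (Fin.castAdd k i') + (c.2 : ℝ)) (lo i) < z (Fin.natAdd B i) ∧
        z (Fin.natAdd B i) < Sum.elim (fun j => z (Fin.natAdd B j))
        (fun c => ∑ i', (c.1 i' : ℝ) * z (Fin.castAdd k i') + (c.2 : ℝ)) (hi i)} ∧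
    EqOn s₁.integrand (fun z => MvPolynomial.aeval (fun i => z (Fin.castAdd k i)) p /
      (∏ j, (∑ i, ((L j).1 i : ℝ) * z (Fin.castAdd k i) + ((L j).2 : ℝ)) ^ e j) *
      ∏ i, (a i).elim 1 (fun c => 1 / (z (Fin.natAdd B i) -
        (∑ i', (c.1 i' : ℝ) * z (Fin.castAdd k i') + (c.2 : ℝ))))) s₁.domain ∧
    w = KZ.of s₁}

/-- The pieces of the two halves of a cut along `h` are pieces of the parent (cut set
`insert h S`). -/
theorem pieces_snoc_subset (L : Fin m → (Fin B → ℚ) × ℚ) (e : Fin m → ℕ)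
    (p : MvPolynomial (Fin B) ℚ) (a : Fin k → Option ((Fin B → ℚ) × ℚ))
    (lo hi : Fin k → Fin k ⊕ ((Fin B → ℚ) × ℚ)) (S : Finset ((Fin B → ℚ) × ℚ))
    (h : (Fin B → ℚ) × ℚ) {m' : ℕ} (M : Fin m' → (Fin B → ℚ) × ℚ)
    (Mc : Fin (m' + 1) → (Fin B → ℚ) × ℚ) (ε₀ : ℚ) (hε₀ : ε₀ = 1 ∨ ε₀ = -1)
    (hMc : Mc = Fin.snoc M (ε₀ • h)) :
    Pieces B k m L e p a lo hi S (m' + 1) Mc ⊆ Pieces B k m L e p a lo hi (insert h S) m' M := by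
  rintro w ⟨m₁, M₁', s₁', hold, hnew, hb, hd, hi', rfl⟩
  refine ⟨m₁, M₁', s₁', fun j => ?_, fun g hg => ?_, hb, hd, hi', rfl⟩
  · obtain ⟨j₁, hj₁⟩ := hold (Fin.castSucc j)
    exact ⟨j₁, by rw [hj₁, hMc, Fin.snoc_castSucc]⟩
  · rcases Finset.mem_insert.1 hg with rfl | hg
    · obtain ⟨j₁, hj₁⟩ := hold (Fin.last m')
      exact ⟨j₁, ε₀, hε₀, by rw [hj₁, hMc, Fin.snoc_last]⟩
    · exact hnew g hg

/-- **Iterated rule (1a)** in base dimension `B` with `k` fibres: cutting a Janus band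
representation (literal `JJ B k` data) successively along the non-zero rational forms of a finite
set `S`. Every resulting piece is literal data with the same integrand data, its rows contain the
old rows and each form of `S` up to sign, and `[s] ≡ ∑ [pieces]`.
[Kontsevich–Zagier 2001, §1.2, rule (1)] -/
theorem cuts (L : Fin m → (Fin B → ℚ) × ℚ) (e : Fin m → ℕ)
    (p : MvPolynomial (Fin B) ℚ) (a : Fin k → Option ((Fin B → ℚ) × ℚ))
    (lo hi : Fin k → Fin k ⊕ ((Fin B → ℚ) × ℚ)) (S : Finset ((Fin B → ℚ) × ℚ)) :
    (0 : (Fin B → ℚ) × ℚ) ∉ S →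
    ∀ (m' : ℕ) (M : Fin m' → (Fin B → ℚ) × ℚ) (s : KZ.IntegralRep (B + k)),
      Bornology.IsBounded s.domain →
      s.domain = {z | (∀ j, 0 < ∑ i, ((M j).1 i : ℝ) * z (Fin.castAdd k i) + ((M j).2 : ℝ)) ∧
        ∀ i, Sum.elim (fun j => z (Fin.natAdd B j)) (fun c => ∑ i', (c.1 i' : ℝ) *
          z (Fin.castAdd k i') + (c.2 : ℝ)) (lo i) < z (Fin.natAdd B i) ∧
          z (Fin.natAdd B i) < Sum.elim (fun j => z (Fin.natAdd B j))
          (fun c => ∑ i', (c.1 i' : ℝ) * z (Fin.castAdd k i') + (c.2 : ℝ)) (hi i)} →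
      EqOn s.integrand (fun z => MvPolynomial.aeval (fun i => z (Fin.castAdd k i)) p /
        (∏ j, (∑ i, ((L j).1 i : ℝ) * z (Fin.castAdd k i) + ((L j).2 : ℝ)) ^ e j) *
        ∏ i, (a i).elim 1 (fun c => 1 / (z (Fin.natAdd B i) -
          (∑ i', (c.1 i' : ℝ) * z (Fin.castAdd k i') + (c.2 : ℝ))))) s.domain →
      ∃ c ∈ AddSubgroup.closure (Pieces B k m L e p a lo hi S m' M),
        KZ.of s - c ∈ KZ.relations := by
  classical
  induction S using Finset.induction_on with
  | empty =>
    intro _ m' M s hbd hdom hint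
    exact ⟨KZ.of s, AddSubgroup.subset_closure ⟨m', M, s, fun j => ⟨j, rfl⟩,
      fun h hh => absurd hh (Finset.notMem_empty h), hbd, hdom, hint, rfl⟩, by simp⟩
  | insert h S hS ih =>
    intro h0 m' M s hbd hdom hint
    have hh : h ≠ 0 := fun hz => h0 (hz ▸ Finset.mem_insert_self h S)
    have h0' : (0 : (Fin B → ℚ) × ℚ) ∉ S := fun hz => h0 (Finset.mem_insert_of_mem hz)
    obtain ⟨M₁, M₂, s₁, s₂, hM₁, hM₂, -, -, -, -, hbd₁, hdom₁, hint₁, hbd₂, hdom₂, hint₂, hrel⟩ :=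
      separatePos_cut B k m m' s M L e p a lo hi hbd hdom hint h hh
    obtain ⟨c₁, hc₁, hr₁⟩ := ih h0' (m' + 1) M₁ s₁ hbd₁ hdom₁ hint₁
    obtain ⟨c₂, hc₂, hr₂⟩ := ih h0' (m' + 1) M₂ s₂ hbd₂ hdom₂ hint₂
    have h1 := AddSubgroup.closure_mono (pieces_snoc_subset L e p a lo hi S h M M₁ 1 (Or.inl rfl)
      (by rw [hM₁, one_smul])) hc₁
    have h2 := AddSubgroup.closure_mono (pieces_snoc_subset L e p a lo hi S h M M₂ (-1)
      (Or.inr rfl) (by rw [hM₂, neg_one_smul])) hc₂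
    refine ⟨c₁ + c₂, add_mem h1 h2, ?_⟩
    have : KZ.of s - (c₁ + c₂) = (KZ.of s - KZ.of s₁ - KZ.of s₂) + (KZ.of s₁ - c₁) +
        (KZ.of s₂ - c₂) := by abel
    rw [this]
    exact add_mem (add_mem hrel hr₁) hr₂

/-- A piece of an iterated cut lies in the parent domain. [folklore] -/
theorem piece_subset {m' m₁ : ℕ} (M : Fin m' → (Fin B → ℚ) × ℚ) (M₁ : Fin m₁ → (Fin B → ℚ) × ℚ)
    (lo hi : Fin k → Fin k ⊕ ((Fin B → ℚ) × ℚ)) (hold : ∀ j, ∃ j₁, M₁ j₁ = M j) :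
    {z : Fin (B + k) → ℝ | (∀ j, 0 < ∑ i, ((M₁ j).1 i : ℝ) * z (Fin.castAdd k i) + ((M₁ j).2 : ℝ)) ∧
      ∀ i, Sum.elim (fun j => z (Fin.natAdd B j)) (fun c => ∑ i', (c.1 i' : ℝ) *
        z (Fin.castAdd k i') + (c.2 : ℝ)) (lo i) < z (Fin.natAdd B i) ∧
        z (Fin.natAdd B i) < Sum.elim (fun j => z (Fin.natAdd B j))
        (fun c => ∑ i', (c.1 i' : ℝ) * z (Fin.castAdd k i') + (c.2 : ℝ)) (hi i)} ⊆
    {z : Fin (B + k) → ℝ | (∀ j, 0 < ∑ i, ((M j).1 i : ℝ) * z (Fin.castAdd k i) + ((M j).2 : ℝ)) ∧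
      ∀ i, Sum.elim (fun j => z (Fin.natAdd B j)) (fun c => ∑ i', (c.1 i' : ℝ) *
        z (Fin.castAdd k i') + (c.2 : ℝ)) (lo i) < z (Fin.natAdd B i) ∧
        z (Fin.natAdd B i) < Sum.elim (fun j => z (Fin.natAdd B j))
        (fun c => ∑ i', (c.1 i' : ℝ) * z (Fin.castAdd k i') + (c.2 : ℝ)) (hi i)} := by
  rintro z ⟨hz1, hz2⟩
  refine ⟨fun j => ?_, hz2⟩
  obtain ⟨j₁, hj₁⟩ := hold j
  have h := hz1 j₁
  rwa [hj₁] at h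

/-- On a piece of an iterated cut every cutting form has a strict constant sign. [folklore] -/
theorem piece_sign {m₁ : ℕ} (M₁ : Fin m₁ → (Fin B → ℚ) × ℚ)
    (lo hi : Fin k → Fin k ⊕ ((Fin B → ℚ) × ℚ)) (h : (Fin B → ℚ) × ℚ)
    (hnew : ∃ j₁, ∃ ε : ℚ, (ε = 1 ∨ ε = -1) ∧ M₁ j₁ = ε • h) :
    (∀ z ∈ {z : Fin (B + k) → ℝ | (∀ j, 0 < ∑ i, ((M₁ j).1 i : ℝ) * z (Fin.castAdd k i) +
      ((M₁ j).2 : ℝ)) ∧ ∀ i, Sum.elim (fun j => z (Fin.natAdd B j)) (fun c => ∑ i', (c.1 i' : ℝ) *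
        z (Fin.castAdd k i') + (c.2 : ℝ)) (lo i) < z (Fin.natAdd B i) ∧
        z (Fin.natAdd B i) < Sum.elim (fun j => z (Fin.natAdd B j))
        (fun c => ∑ i', (c.1 i' : ℝ) * z (Fin.castAdd k i') + (c.2 : ℝ)) (hi i)},
      0 < ∑ i, (h.1 i : ℝ) * z (Fin.castAdd k i) + (h.2 : ℝ)) ∨
    (∀ z ∈ {z : Fin (B + k) → ℝ | (∀ j, 0 < ∑ i, ((M₁ j).1 i : ℝ) * z (Fin.castAdd k i) +
      ((M₁ j).2 : ℝ)) ∧ ∀ i, Sum.elim (fun j => z (Fin.natAdd B j)) (fun c => ∑ i', (c.1 i' : ℝ) *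
        z (Fin.castAdd k i') + (c.2 : ℝ)) (lo i) < z (Fin.natAdd B i) ∧
        z (Fin.natAdd B i) < Sum.elim (fun j => z (Fin.natAdd B j))
        (fun c => ∑ i', (c.1 i' : ℝ) * z (Fin.castAdd k i') + (c.2 : ℝ)) (hi i)},
      ∑ i, (h.1 i : ℝ) * z (Fin.castAdd k i) + (h.2 : ℝ) < 0) := by
  obtain ⟨j₁, ε, hε, hj₁⟩ := hnew
  rcases hε with rfl | rfl
  · refine Or.inl fun z hz => ?_
    have h1 := hz.1 j₁
    rwa [hj₁, one_smul] at h1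
  · refine Or.inr fun z hz => ?_
    have h1 := hz.1 j₁
    rw [hj₁, neg_one_smul, SeparatePos.form_neg] at h1
    linarith

end SepHigh

open SepHigh in
/-- **Iterated rule (1a) in base dimension `B` with `k` fibres** (registered part of
`stub_separateHigh`; literal form of `SepHigh.cuts`). [Kontsevich–Zagier 2001, §1.2, rule (1)] -/
theorem separateHigh_cuts (B k m : ℕ) (L : Fin m → (Fin B → ℚ) × ℚ) (e : Fin m → ℕ) (p : MvPolynomial (Fin B) ℚ) (a : Fin k → Option ((Fin B → ℚ) × ℚ)) (lo hi : Fin k → Fin k ⊕ ((Fin B → ℚ) × ℚ)) (S : Finset ((Fin B → ℚ) × ℚ)) (hS : (0 : (Fin B → ℚ) × ℚ) ∉ S) (m' : ℕ) (M : Fin m' → (Fin B → ℚ) × ℚ) (s : KZ.IntegralRep (B + k)) (hbd : Bornology.IsBounded s.domain) (hdom : s.domain = {z | (∀ j, 0 < ∑ i, ((M j).1 i : ℝ) * z (Fin.castAdd k i) + ((M j).2 : ℝ)) ∧ ∀ i, Sum.elim (fun j => z (Fin.natAdd B j)) (fun c => ∑ i', (c.1 i' : ℝ) * z (Fin.castAdd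 k i') + (c.2 : ℝ)) (lo i) < z (Fin.natAdd B i) ∧ z (Fin.natAdd B i) < Sum.elim (fun j => z (Fin.natAdd B j)) (fun c => ∑ i', (c.1 i' : ℝ) * z (Fin.castAdd k i') + (c.2 : ℝ)) (hi i)}) (hint : EqOn s.integrand (fun z => MvPolynomial.aeval (fun i => z (Fin.castAdd k i)) p / (∏ j, (∑ i, ((L j).1 i : ℝ) * z (Fin.castAdd k i) + ((L j).2 : ℝ)) ^ e j) * ∏ i, (a i).elim 1 (fun c => 1 / (z (Fin.natAdd B i) - (∑ i', (c.1 i' : ℝ) * z (Fin.castAdd k i') + (c.2 : ℝ))))) s.domain) : ∃ c ∈ AddSubgroup.closure {w : KZ.FormalRep | ∃ (m₁ : ℕ) (M₁ : Fin m₁ → (Fin B → ℚ) × ℚ) (s₁ : KZ.IntegralRep (B + k)), (∀ j, ∃ j₁, M₁ j₁ = M j) ∧ (∀ h ∈ S, ∃ j₁, ∃ ε : ℚ, (ε = 1 ∨ ε = -1) ∧ M₁ j₁ = ε • h) ∧ Bornology.IsBounded s₁.domain ∧ s₁.domain = {z | (∀ j, 0 < ∑ i, ((M₁ j).1 i : ℝ)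 * z (Fin.castAdd k i) + ((M₁ j).2 : ℝ)) ∧ ∀ i, Sum.elim (fun j => z (Fin.natAdd B j)) (fun c => ∑ i', (c.1 i' : ℝ) * z (Fin.castAdd k i') + (c.2 : ℝ)) (lo i) < z (Fin.natAdd B i) ∧ z (Fin.natAdd B i) < Sum.elim (fun j => z (Fin.natAdd B j)) (fun c => ∑ i', (c.1 i' : ℝ) * z (Fin.castAdd k i') + (c.2 : ℝ)) (hi i)} ∧ EqOn s₁.integrand (fun z => MvPolynomial.aeval (fun i => z (Fin.castAdd k i)) p / (∏ j, (∑ i, ((L j).1 i : ℝ) * z (Fin.castAdd k i) + ((L j).2 : ℝ)) ^ e j) * ∏ i, (a i).elim 1 (fun c => 1 / (z (Fin.natAdd B i) - (∑ i', (c.1 i' : ℝ) * z (Fin.castAdd k i') + (c.2 : ℝ))))) s₁.domain ∧ w = KZ.of s₁}, KZ.of s - c ∈ KZ.relations :=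
  cuts L e p a lo hi S hS m' M s hbd hdom hint

end Summit.KontsevichZagierPeriods.ArrangementNormalForm.JanusBands
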